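import Literature.Computability.Complexity.Hastad3SatCNFSound
import Literature.Computability.Complexity.BlockSmoothing
import HarnessLib

/-!
# Håstad's 7/8 + ε theorem at the level of formulas, for any projection game of small value

Håstad, *Some optimal inapproximability results*, J. ACM 48 (2001), Thm 6.5, in the form the tree's
files prove it (`LongCodeFourier`, `Hastad3SatTest`, `Hastad3SatEstimates`, `Hastad3SatSmooth`,
`Hastad3SatGame`, `Hastad3SatCNF`, `Hastad3SatCNFSound`, `BlockSmoothing`), assembled: from a unit-weight
projection game `H` that is regular on Bob's side and has at least two admissible labels at every vertex
of Bob (in the application: a parallel repetition of the projection game of a regular constraint graph),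
and a precision `k ≥ 8`, an explicit E3-CNF

  `hastadCNF H k hyp = (hastadData H k hyp).hCNF` on the block game `H.block (16 k⁵) …` with `ε = 1/k`,

such that (everything PROVED)

* `isExactWidth_hastadCNF` — every clause has three literals on three distinct variables;
* `satisfiable_hastadCNF` — **completeness**: if `H` has perfect strategies, the CNF is satisfiable;
* `maxSatFraction_hastadCNF_le` — **soundness**: if `val(H) ≤ 1/(4 k⁴)`, every assignment satisfies
  at most a fraction `7/8 + 2/k` of the clauses.

The parameters inside (`ε = 1/k`, `T = 4k²` for the size threshold of the Fourier sets, `L = 16 k⁵`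
blocks, `r = k` for the projection images) make each of the five error terms of `testAcc_soundness` at
most `2/k` and the dropped degenerate clauses cost at most `1/k` (`Hastad3SatCNFSound`).  What this
file does NOT contain: the hardness of the input games (PCP theorem and parallel repetition — in the
tree: `ConstraintGraphGame.dartGame_pow_valLe` for regular expanding constraint graphs) and the
polynomial-time machine rendering of `H ↦ hastadCNF` (the statement `hastad_seven_eighths` of
`Approximation.lean` is about `FP` reductions).

## References

* J. Håstad, *Some optimal inapproximability results*, J. ACM 48 (2001) 798–859, Thm 6.5 and its proof
  (§6.1, Lemmas 6.6–6.13) [Hastad2001].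
-/

noncomputable section

namespace Literature.Computability.Complexity

namespace ProjGame

open Finset Literature.Probability.RandomGraphs.LowDegree Literature.Computability.Complexity.LongCode
  Literature.Computability.Complexity.Hastad3Sat

variable {E V U β α : Type} [Fintype E] [Fintype V] [Fintype U] [Fintype β] [Fintype α]
  [DecidableEq E] [DecidableEq V] [DecidableEq U] [DecidableEq β] [DecidableEq α]

/-- The hypotheses on the input game: unit weights, Bob-regular, and two distinct admissible labels at
every vertex of Bob. [cite: Hastad2001, §6.1 (the u-parallel two-prover protocol)] -/
structure HastadHyp (H : ProjGame E V U β α) where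
  /-- unit weights -/
  unit : ∀ e, H.wt e = 1
  /-- the common weight of Bob's vertices -/
  ω : ℝ
  /-- Bob-regularity -/
  reg : ∀ v, H.wV v = ω
  /-- a first admissible label -/
  lab0 : V → β
  /-- a second admissible label -/
  lab1 : V → β
  /-- they are admissible -/
  adm0 : ∀ v, H.Adm v (lab0 v)
  /-- they are admissible -/
  adm1 : ∀ v, H.Adm v (lab1 v)
  /-- they differ -/
  ne01 : ∀ v, lab0 v ≠ lab1 v
  /-- a label of Alice -/
  a₀ : α
  /-- a vertex of Bob -/
  v₀ : V

variable (H : ProjGame E V U β α) (k : ℕ) (hyp : HastadHyp H)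

/-- The number of blocks `L = 16 k⁵`. [cite: Hastad2001, §6.1 (choice of u)] -/
def nBlocks : ℕ := 16 * k ^ 5

omit [Fintype E] [Fintype V] [Fintype U] [Fintype β] [Fintype α] [DecidableEq E] [DecidableEq V]
  [DecidableEq U] [DecidableEq β] [DecidableEq α] in
/-- `L > 0` for `k > 0`. [folklore] -/
theorem nBlocks_pos (hk : 0 < k) : 0 < nBlocks k := by unfold nBlocks; positivity

/-- **The block game used for the reduction**: `H.block L` with `L = 16 k⁵`, blanks `v₀`, `lab0 v₀`
(reducible). [cite: Hastad2001, §6.1] -/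
abbrev hGame (hk : 0 < k) :=
  H.block (nBlocks k) (nBlocks_pos k hk) hyp.v₀ (hyp.lab0 hyp.v₀)

/-- An admissible label of Bob's vertex `w` of the block game: blockwise `lab0`. [folklore] -/
def baseLab (hk : 0 < k) (w : Fin (nBlocks k) → V) : (H.hGame k hyp hk).Lab w :=
  ⟨fun ℓ => hyp.lab0 (w ℓ), (H.adm_block_iff _ _ _ _ w _).2 fun ℓ => hyp.adm0 (w ℓ)⟩

/-- **The data of the CNF**: `ε = 1/k`, arbitrary base points, numberings by enumeration of the finite
types of table entries (Alice first, then Bob), `K⋆ = |β|^L`. [cite: Hastad2001, §6.1 (proof of Thm 6.5)] -/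
def hastadData (hk : 0 < k) : (H.hGame k hyp hk).CNFData where
  p := 1
  q := k
  p_le := hk
  xA := fun _ => (fun _ => hyp.lab0 hyp.v₀, hyp.a₀)
  yB := H.baseLab k hyp hk
  nA := fun u f => (Fintype.equivFin (Σ _u : BlockU V U (nBlocks k) hyp.v₀, ((Fin (nBlocks k) → β) × α → Bool)) ⟨u, f⟩).val
  nB := fun w g => Fintype.card (Σ _u : BlockU V U (nBlocks k) hyp.v₀, ((Fin (nBlocks k) → β) × α → Bool)) +
    (Fintype.equivFin (Σ w : Fin (nBlocks k) → V, ((H.hGame k hyp hk).Lab w → Bool)) ⟨w, g⟩).val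
  Kstar := Fintype.card (Fin (nBlocks k) → β)

/-- **Håstad's E3-CNF** for the game `H` at precision `k`. [cite: Hastad2001, Thm 6.5] -/
def hastadCNF (hk : 0 < k) : CNF ℕ := (H.hastadData k hyp hk).hCNF

omit [DecidableEq E] [DecidableEq U] in
/-- The numbering by enumeration is good (injective on each side, disjoint ranges). [folklore] -/
theorem goodNumbering_hastadData (hk : 0 < k) : (H.hastadData k hyp hk).GoodNumbering where
  injA := by
    intro u u' f f' h
    have h' := Fin.val_injective h
    have h'' := (Fintype.equivFin _).injective h'
    simp only [Sigma.mk.injEq] at h''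
    exact h''
  injB := by
    intro w w' g g' h
    have h' := Fin.val_injective (Nat.add_left_cancel h)
    have h'' := (Fintype.equivFin _).injective h'
    simp only [Sigma.mk.injEq] at h''
    exact h''
  disj := by
    intro u f w g h
    have hlt := (Fintype.equivFin (Σ _u : BlockU V U (nBlocks k) hyp.v₀, ((Fin (nBlocks k) → β) × α → Bool)) ⟨u, f⟩).isLt
    simp only [hastadData] at h
    omega

omit [DecidableEq E] [DecidableEq U] in
/-- **Exact width three.** [cite: Hastad2001, Thm 6.5 (E3-CNF)] -/
theorem isExactWidth_hastadCNF (hk : 0 < k) : (H.hastadCNF k hyp hk).IsExactWidth 3 :=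
  (H.hastadData k hyp hk).isExactWidth_hCNF (H.goodNumbering_hastadData k hyp hk)

omit [DecidableEq E] [DecidableEq U] in
/-- **Completeness**: perfect strategies of `H` make the CNF satisfiable.
[cite: Hastad2001, Lemma 6.12 (completeness)] -/
theorem satisfiable_hastadCNF (hk : 0 < k) {b : V → β} {a : U → α}
    (hsat : ∀ e, H.proj e (b (H.src e)) = some (a (H.dst e))) : (H.hastadCNF k hyp hk).Satisfiable :=
  (H.hastadData k hyp hk).satisfiable_hCNF (H.goodNumbering_hastadData k hyp hk)
    (b := fun w ℓ => b (w ℓ))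
    (a := fun p => (Function.update (fun ℓ => b (p.1.2.1 ℓ)) p.1.1 (hyp.lab0 hyp.v₀), a p.1.2.2))
    (H.block_sat (nBlocks k) (nBlocks_pos k hk) hyp.v₀ (hyp.lab0 hyp.v₀) hsat)

/-! ### The projection images of the block game are large -/

omit [Fintype U] [Fintype α] [DecidableEq E] [DecidableEq U] in
/-- At an edge of the block game in block `ℓ`, the projection image of the admissible labels has at
least `2^{L-1} ≥ L` points: blanking block `ℓ` keeps the other `L - 1` blocks, each of which carries two
distinct admissible labels. [cite: Hastad2001, §6.1 (E3 clauses: the functions f are rarely constant)] -/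
theorem card_image_tproj_ge (hk : 0 < k) (ℓ : Fin (nBlocks k)) (vs : Fin (nBlocks k) → V) (e' : E) :
    nBlocks k - 1 ≤ ((univ : Finset ((H.hGame k hyp hk).Lab ((H.hGame k hyp hk).src (ℓ, vs, e')))).image
      ((H.hGame k hyp hk).tproj _ (CNFData.edgeAt (ℓ, vs, e')))).card := by
  set w : Fin (nBlocks k) → V := (H.hGame k hyp hk).src (ℓ, vs, e') with hw
  set j : (H.hGame k hyp hk).EdgeAt w := CNFData.edgeAt (ℓ, vs, e') with hj
  -- an injection from `{m // m ≠ ℓ} → Bool` into the image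
  let ys : ({m : Fin (nBlocks k) // m ≠ ℓ} → Bool) → (Fin (nBlocks k) → β) := fun s m =>
    if h : m = ℓ then hyp.lab0 (w m) else (if s ⟨m, h⟩ then hyp.lab1 (w m) else hyp.lab0 (w m))
  have hadm : ∀ s, (H.hGame k hyp hk).Adm w (ys s) := by
    intro s
    rw [H.adm_block_iff]
    intro m
    simp only [ys]
    split_ifs
    · exact hyp.adm0 _
    · exact hyp.adm1 _
    · exact hyp.adm0 _
  let F : ({m : Fin (nBlocks k) // m ≠ ℓ} → Bool) → (Fin (nBlocks k) → β) × α := fun s =>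
    (H.hGame k hyp hk).tproj w j ⟨ys s, hadm s⟩
  have hF : ∀ s, F s ∈ (univ : Finset ((H.hGame k hyp hk).Lab w)).image ((H.hGame k hyp hk).tproj w j) :=
    fun s => mem_image_of_mem _ (mem_univ _)
  have hj1 : j.1.1 = ℓ := rfl
  have hinj : Function.Injective F := by
    intro s s' h
    have h1 := H.tproj_block_fst (nBlocks k) (nBlocks_pos k hk) hyp.v₀ (hyp.lab0 hyp.v₀) w j ⟨ys s, hadm s⟩
    have h2 := H.tproj_block_fst (nBlocks k) (nBlocks_pos k hk) hyp.v₀ (hyp.lab0 hyp.v₀) w j ⟨ys s', hadm s'⟩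
    rw [hj1] at h1 h2
    have h12 : Function.update (ys s) ℓ (hyp.lab0 hyp.v₀) = Function.update (ys s') ℓ (hyp.lab0 hyp.v₀) := by
      rw [← h1, ← h2]; exact congrArg Prod.fst h
    funext ⟨m, hm⟩
    have hm' := congrFun h12 m
    rw [Function.update_of_ne hm, Function.update_of_ne hm] at hm'
    simp only [ys, dif_neg hm] at hm'
    cases hs : s ⟨m, hm⟩ <;> cases hs' : s' ⟨m, hm⟩
    · rfl
    · rw [hs, hs'] at hm'; simp at hm'; exact absurd hm' (hyp.ne01 _)
    · rw [hs, hs'] at hm'; simp at hm'; exact absurd hm'.symm (hyp.ne01 _)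
    · rfl
  have hcard : Fintype.card ({m : Fin (nBlocks k) // m ≠ ℓ} → Bool) ≤
      ((univ : Finset ((H.hGame k hyp hk).Lab w)).image ((H.hGame k hyp hk).tproj w j)).card := by
    rw [← card_univ, ← card_image_of_injective univ hinj]
    exact card_le_card fun x hx => by
      obtain ⟨s, -, rfl⟩ := mem_image.1 hx
      exact hF s
  refine le_trans ?_ hcard
  rw [Fintype.card_fun, Fintype.card_bool, Fintype.card_subtype_compl, Fintype.card_subtype_eq,
    Fintype.card_fin]
  exact Nat.lt_two_pow_self.le

/-! ### Soundness: the parameters -/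

omit [Fintype E] [Fintype V] [Fintype U] [Fintype β] [Fintype α] [DecidableEq E] [DecidableEq V]
  [DecidableEq U] [DecidableEq β] [DecidableEq α] in
/-- `e^{-x} ≤ 1/x` for `x > 0`. [folklore] -/
theorem exp_neg_le_inv {x : ℝ} (hx : 0 < x) : Real.exp (-x) ≤ 1 / x := by
  rw [Real.exp_neg, ← one_div]
  exact one_div_le_one_div_of_le hx (by have := Real.add_one_le_exp x; linarith)

omit [Fintype E] [Fintype V] [Fintype U] [Fintype β] [Fintype α] [DecidableEq E] [DecidableEq V]
  [DecidableEq U] [DecidableEq β] [DecidableEq α] in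
/-- `2/2^k ≤ 1/k` for `k ≥ 1`. [folklore] -/
theorem two_div_two_pow_le (hk : 1 ≤ k) : (2 : ℝ) / 2 ^ k ≤ 1 / k := by
  have hk0 : (0 : ℝ) < k := by exact_mod_cast hk
  rw [div_le_div_iff₀ (by positivity) hk0, one_mul]
  have h : k ≤ 2 ^ (k - 1) := Nat.lt_two_pow_self.le.trans' (by omega) |> fun _ => by
    have := @Nat.lt_two_pow_self (k - 1)
    omega
  calc (2 : ℝ) * k ≤ 2 * 2 ^ (k - 1) := by exact_mod_cast Nat.mul_le_mul_left 2 h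
    _ = 2 ^ k := by rw [← pow_succ']; congr 1; omega

/-- **Soundness** (Håstad 2001, Thm 6.5 with the two-prover soundness explicit): if `val(H) ≤ 1/(4k⁴)`
(`k ≥ 8`), every assignment satisfies at most a fraction `7/8 + 2/k` of the clauses of `hastadCNF H k`.
[cite: Hastad2001, Thm 6.5] -/
theorem maxSatFraction_hastadCNF_le [Nonempty E] (hk : 8 ≤ k) (hval : H.ValLe (1 / (4 * (k : ℝ) ^ 4))) :
    ((H.hastadCNF k hyp (by omega)).maxSatFraction : ℝ) ≤ 7 / 8 + 2 / k := by
  have hk0 : 0 < k := by omega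
  set M := H.hGame k hyp hk0 with hM
  set D := H.hastadData k hyp hk0 with hD
  have hkR : (8 : ℝ) ≤ k := by exact_mod_cast hk
  have hkpos : (0 : ℝ) < k := by linarith
  haveI : Nonempty (Fin (nBlocks k) × (Fin (nBlocks k) → V) × E) :=
    ⟨(⟨0, nBlocks_pos k hk0⟩, fun _ => hyp.v₀, Classical.arbitrary E)⟩
  -- the parameters
  set T : ℕ := 4 * k ^ 2 with hT
  have hε : D.eps = 1 / k := by simp [hD, hastadData, CNFData.eps]
  have hθ0 : (0 : ℝ) ≤ 1 / (4 * (k : ℝ) ^ 4) := by positivity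
  -- value and smoothness of the block game
  have hvalM : M.ValLe (1 / (4 * (k : ℝ) ^ 4)) := H.block_valLe _ _ _ _ hval
  have hsm : M.SmoothAt T ((T : ℝ) ^ 2 / nBlocks k) := H.block_smoothAt _ _ _ _ hyp.reg T
  have hξ : (T : ℝ) ^ 2 / nBlocks k = 1 / k := by
    rw [hT]; unfold nBlocks; push_cast; field_simp; ring
  rw [hξ] at hsm
  -- the acceptance probability of the test on `M`
  have hτ : ∀ (A : BlockU V U (nBlocks k) hyp.v₀ → ((Fin (nBlocks k) → β) × α → Bool) → Bool)
      (B : ∀ w, (M.Lab w → Bool) → Bool), (∀ u, IsFolded (A u)) → (∀ w, IsFolded (B w)) →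
      M.testAcc D.eps A B ≤ 7 / 8 + 7 / (8 * k) := by
    intro A B hA hB
    have h := M.testAcc_soundness (ε := D.eps) (ξ := 1 / k) (θ := 1 / (4 * (k : ℝ) ^ 4)) (T := T)
      (by rw [hε]; positivity) (by rw [hε, div_le_iff₀ hkpos]; linarith) (by positivity) hθ0 hvalM hsm hA hB
    -- the five error terms
    have e1 : Real.exp (-(T * D.eps) / 4) ≤ 1 / k := by
      have : -((T : ℝ) * D.eps) / 4 = -k := by rw [hε, hT]; push_cast; field_simp
      rw [this]
      exact exp_neg_le_inv hkpos
    have e2 : Real.exp (-(T * D.eps) / 8) ≤ 2 / k := by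
      have : -((T : ℝ) * D.eps) / 8 = -(k / 2) := by rw [hε, hT]; push_cast; field_simp; ring
      rw [this]
      refine (exp_neg_le_inv (by positivity)).trans (le_of_eq ?_)
      field_simp
    have e3 : Real.sqrt (T * (1 / (4 * (k : ℝ) ^ 4))) = 1 / k := by
      rw [hT]; push_cast
      rw [show (4 : ℝ) * k ^ 2 * (1 / (4 * k ^ 4)) = (1 / k) ^ 2 by field_simp]
      exact Real.sqrt_sq (by positivity)
    rw [e3, hε] at h
    rw [hε] at e1 e2
    have : 8 * (M.testAcc (1 / k) A B - 7 / 8) ≤ 7 / k := by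
      calc 8 * (M.testAcc (1 / k) A B - 7 / 8) ≤ 1 / k + Real.exp (-(T * (1 / k)) / 4) +
            Real.exp (-(T * (1 / k)) / 8) + 2 * (1 / k) + 1 / k := h
        _ ≤ 1 / k + 1 / k + 2 / k + 2 * (1 / k) + 1 / k := by linarith
        _ = 7 / k := by ring
    rw [hε]
    have h8 : M.testAcc (1 / k) A B ≤ 7 / 8 + 7 / k / 8 := by linarith
    calc M.testAcc (1 / k) A B ≤ 7 / 8 + 7 / k / 8 := h8
      _ = 7 / 8 + 7 / (8 * k) := by ring
  -- the value of the formula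
  have hK : ∀ w, Fintype.card (M.Lab w) ≤ D.Kstar := fun w => Fintype.card_subtype_le _
  have hr : ∀ e, k ≤ ((univ : Finset (M.Lab (M.src e))).image (M.tproj _ (CNFData.edgeAt e))).card := by
    rintro ⟨ℓ, vs, e'⟩
    refine le_trans ?_ (H.card_image_tproj_ge k hyp hk0 ℓ vs e')
    unfold nBlocks
    have : k ≤ 16 * k ^ 5 - 1 := by
      have h1 : k ^ 1 ≤ k ^ 5 := Nat.pow_le_pow_right hk0 (by norm_num)
      have h2 : 2 * k ≤ 16 * k ^ 5 := by nlinarith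
      omega
    exact this
  obtain ⟨σ, hσ⟩ := (H.hastadCNF k hyp hk0).exists_maxSatFraction_eq
  have hτ1 : (7 : ℝ) / 8 + 7 / (8 * k) ≤ 1 := by
    have : (7 : ℝ) / (8 * k) ≤ 7 / 64 := by
      rw [div_le_div_iff₀ (by positivity) (by norm_num)]; nlinarith
    linarith
  have hmain := D.satisfiedFraction_hCNF_le (fun e => by simp [hGame, block_wt, hyp.unit]) hk0
    (by show 4 * 1 ≤ k; omega) hK (r := k) (by omega) hr (τ := 7 / 8 + 7 / (8 * k)) hτ1 hτ σ
  rw [show H.hastadCNF k hyp hk0 = D.hCNF from rfl] at hσ ⊢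
  rw [hσ]
  refine hmain.2.trans ?_
  have h2k := two_div_two_pow_le k (by omega)
  have : (7 : ℝ) / (8 * k) + 1 / k ≤ 2 / k := by
    rw [div_add_div _ _ (by positivity) hkpos.ne', div_le_div_iff₀ (by positivity) hkpos]
    nlinarith
  linarith

/-- The same bound in `ℚ`. [cite: Hastad2001, Thm 6.5] -/
theorem maxSatFraction_hastadCNF_le_rat [Nonempty E] (hk : 8 ≤ k) (hval : H.ValLe (1 / (4 * (k : ℝ) ^ 4))) :
    (H.hastadCNF k hyp (by omega)).maxSatFraction ≤ 7 / 8 + 2 / k := by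
  have h := H.maxSatFraction_hastadCNF_le k hyp hk hval
  have : ((7 / 8 + 2 / k : ℚ) : ℝ) = 7 / 8 + 2 / k := by push_cast; ring
  rw [← this] at h
  exact_mod_cast h

end ProjGame

end Literature.Computability.Complexity

end
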